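import Summits.ResolutionOfSingularities.ResolutionOfSingularities.Theorems.PurelyInseparableDim4NarrowApolarity
import Summits.ResolutionOfSingularities.ResolutionOfSingularities.Theorems.PurelyInseparableDim4NarrowRidgeTransversal
import Summits.ResolutionOfSingularities.ResolutionOfSingularities.Theorems.PurelyInseparableDim4JetColength
import Summits.ResolutionOfSingularities.ResolutionOfSingularities.Theorems.PurelyInseparableDim4NarrowPullback
import Summits.ResolutionOfSingularities.ResolutionOfSingularities.Theorems.PurelyInseparableDim4IsolationBudget
import HarnessLib

/-!
# (N1) THE NARROW EDGE LAW — `RidgeBudget.NarrowDrop p p` holds for every prime `p` (cell `res-dim4-pi`)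

[OURS · counted 0 · ASSEMBLY of the cell's CARD I-3-10 (seat idea-3; memo `iso6/N1-PROOF-v2.md`;
independent hand proofs crit-4 V-A4-09/V-A4-11 (q = p = 3), crit-1 V-A-26, crit-2 V-B-34 (all p ≥ 3,
vacuous at p = 2)); kernel pieces: L0/L1 `…NarrowApolarity` (p-1 g2, p661824), L2
`…NarrowPullback` (p-5 g2, p661331), L3 `…NarrowRidgeTransversal` (p-7 g2, p661385), colength
calculus `…JetColength` (p-3 g2, p661642/p661862).  Nothing here is a statement of any manuscript and
nothing here proves `NoWideTrap`, `NoIsolatedTrap 3 3` or resolution of singularities in dimension ≥ 4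
/ characteristic `p`.  Qualitative prior art for the conclusion: [CJS 2020] Cor. 6.37 (isolated,
`e = 1` ⇒ finitely many point blow-ups); the quantitative colength form is the cell's.]

* §1 the inputs at the parent: `J_p⁺ ≤ 𝔪₀` at order `p`; `A(in F) ≠ 0` at a state with an equimultiple
  point; hence **`μ⁺ ≥ 2`** (`two_le_jetColength_of_isEquimultiplePoint`).
* §2 **(N1⁺) `jetColength_step_succ_le`**: `ord₀ s.F = p`, `ē(s) = 1`, certificate at `N`, `(j, b)`
  equimultiple ⇒ `jetColength p N' s⁺.F + 1 ≤ μ⁺(s)` at EVERY level `N'` (no hypothesis on `s⁺`);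
  `jetColength_step_lt`; **`isIsolated_step_of_ebar_eq_one`** (child isolation is automatic).
* §3 **`narrowDrop (p) [Fact p.Prime] : RidgeBudget.NarrowDrop p p`** — the tree's typed census law
  (p659279) BY NAME.  (With it, idea-3's `noIsolatedTrap_of_trichotomy p (narrowDrop p)` is the
  splitting `F4-I(p,p) ⟸ NoWideTrap p p ∧ NoAboveFloorTrap p p`, already in the tree as p-12 g2's
  `RidgeBudget.noIsolatedTrap_of_residual` via the cone theorem FT(p,p) — not restated here.)

bears_on: LADDER-RESOLUTION:D157-DOOR2 (res-dim4-pi · F4-I(p,p) narrow branch · (N1) ✓).  Seat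
res-dim4-p-1 g2 (desk WORDs #41/#43: assembly).  Supports stmt-ResolutionOfSingularities-16155 (helper).
-/

set_option linter.dupNamespace false

noncomputable section

namespace Summit.ResolutionOfSingularities.ResolutionOfSingularities.Theorems.PIDim4

namespace RidgeBudget

open MvPolynomial Finset
open Literature.AlgebraicGeometry.Resolution
open Literature.AlgebraicGeometry.Resolution.Hauser2010
open Literature.AlgebraicGeometry.Resolution.HauserPerlega2019
open PointBlowup (direction additiveSubspace)

variable {K : Type} [Field K]

/-! ## 1. The pieces at the parent state -/

/-- `J_q⁺(F) ≤ 𝔪₀` at a point of order exactly `q`: every Hasse derivative of order `< q` has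
vanishing constant term. [folklore] -/
theorem singLocusIdeal_le_originIdeal_of_ordZero_eq {q : ℕ} {F : MvPolynomial (Fin 4) K}
    (hord : ordZero F = q) : singLocusIdeal q F ≤ originIdeal K :=
  IsolationCert.singLocusIdeal_le_originIdeal_of_forall fun α _ hα => by
    show coeff 0 (hasseDeriv α F) = 0
    rw [IsolatedBand.coeff_hasseDeriv, zero_add, NarrowApolarity.coeff_eq_zero_of_degree_lt hord hα,
      mul_zero]

/-- The additive subspace of the initial form at a state admitting an equimultiple point is
non-trivial (it contains the direction `e_j + b`). [cite: CossartJannsenSaito2020, Thm. 3.14] -/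
theorem additiveSubspace_ne_bot_of_isEquimultiplePoint (p : ℕ) [Fact p.Prime] [CharP K p]
    [DecidableEq K] {s : State K} (hord : ordZero s.F = p) {j : Fin 4} {b : Fin 4 → K}
    (hbj : b j = 0) (heq : CentreBlowup.IsEquimultiplePoint p Finset.univ j b s) :
    additiveSubspace (initialForm s.F) ≠ ⊥ := by
  intro h
  have hw := Directrix.direction_mem_additiveSubspace p hord hbj heq
  rw [h, Submodule.mem_bot] at hw
  exact Directrix.direction_ne_zero j b hw

/-- **`μ⁺ ≥ 2` at a floor state with an equimultiple point** (embedding dimension `ē ≥ 1`).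
[OURS · (N1) assembly] [folklore] -/
theorem two_le_jetColength_of_isEquimultiplePoint (p : ℕ) [Fact p.Prime] [CharP K p]
    [DecidableEq K] {s : State K} (hord : ordZero s.F = p) {N : ℕ} (hN : IsCert p N s.F)
    {j : Fin 4} {b : Fin 4 → K} (hbj : b j = 0)
    (heq : CentreBlowup.IsEquimultiplePoint p Finset.univ j b s) : 2 ≤ jetColength p N s.F :=
  two_le_jetColength (singLocusIdeal_le_originIdeal_of_ordZero_eq hord)
    (NarrowApolarity.not_originIdeal_le_sup hord
      (additiveSubspace_ne_bot_of_isEquimultiplePoint p hord hbj heq)) hN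

/-! ## 2. (N1⁺): one narrow edge costs at least one unit of `μ⁺` -/

/-- **(N1⁺) — THE NARROW EDGE LAW.**  Let `s` be a state of order exactly `p` whose tangent cone
has a one-dimensional ridge (`ē(s) = 1`), with an isolation certificate at level `N`
(`μ⁺(s) = jetColength p N s.F`).  Then at EVERY equimultiple point `(j, b)` (`b_j = 0`) of the point
blow-up, the cleaned successor `s⁺` satisfies, at EVERY level `N'`,
`jetColength p N' s⁺.F + 1 ≤ μ⁺(s)`.
PROOF (CARD I-3-10, memo N1-PROOF-v2 of seat idea-3; hand proofs crit-4 V-A4-09/V-A4-11, crit-1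
V-A-26, crit-2 V-B-34): `x_j^{μ} ∈ J⁺(s) + 𝔪₀ᴹ ∀M` (nilpotency, p-3 g2 `X_pow_jetColength_mem`) ⟹
`x_j^{μ−1} ∈ J⁺(s⁺) + 𝔪₀ᴹ ∀M` (Kollár pull-back L2 of p-5 g2 + cancellation (U)); at `s⁺` the order is
`p` again and `ē(s⁺) ∈ {0, 1}` (L3 of p-7 g2); if `ē(s⁺) = 1` the new ridge vector has `w'_j ≠ 0`
(L3) and APOLARITY L1a gives `𝔪₀ ≤ (x_j) + J⁺(s⁺) + 𝔪₀²`, so the span lemma bounds `μ⁺(s⁺) ≤ μ − 1`;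
if `ē(s⁺) = 0`, `𝔪₀ ≤ J⁺(s⁺) + 𝔪₀²` and `μ⁺(s⁺) ≤ 1 ≤ μ − 1` since `μ ≥ 2`.
[OURS · (N1⁺) of CARD I-3-10 · counted 0] [cite: CossartJannsenSaito2020, Cor. 6.37 (qualitative prior art)] -/
theorem jetColength_step_succ_le (p : ℕ) [Fact p.Prime] [CharP K p] [DecidableEq K] {s : State K}
    (hord : ordZero s.F = p) (he : ebar s.F = 1) {N : ℕ} (hN : IsCert p N s.F) {j : Fin 4}
    {b : Fin 4 → K} (hbj : b j = 0) (heq : CentreBlowup.IsEquimultiplePoint p Finset.univ j b s)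
    (N' : ℕ) :
    jetColength p N' (CentreBlowup.step p Finset.univ j b s).F + 1 ≤ jetColength p N s.F := by
  have hp2 : 2 ≤ p := (Fact.out : p.Prime).two_le
  have hperm : (p : ℕ∞) ≤ CentreBlowup.ordAlong Finset.univ s.F :=
    Directrix.le_ordAlong_univ_of_ordZero_eq hord
  have hμ2 : 2 ≤ jetColength p N s.F := two_le_jetColength_of_isEquimultiplePoint p hord hN hbj heq
  -- `x_j^μ ∈ J⁺(s) ⊔ 𝔪₀ᴹ` for every `M`
  have hx : ∀ M : ℕ, (X j : MvPolynomial (Fin 4) K) ^ jetColength p N s.F ∈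
      singLocusIdeal p s.F ⊔ originIdeal K ^ M := fun M => X_pow_jetColength_mem hN j M
  -- cancellation of one `x_j` through the chart pull-back
  have hx' : ∀ M : ℕ, (X j : MvPolynomial (Fin 4) K) ^ (jetColength p N s.F - 1) ∈
      singLocusIdeal p (CentreBlowup.step p Finset.univ j b s).F ⊔ originIdeal K ^ M :=
    fun M => by
      have hμ : jetColength p N s.F - 1 + 1 = jetColength p N s.F := by omega
      refine X_pow_mem_sup_pow_of_succ_mem ?_
      rw [hμ]
      have himg : (aeval (fun i => if i = j then (X j : MvPolynomial (Fin 4) K)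
          else X j * (X i + C (b i)))).toRingHom ((X j : MvPolynomial (Fin 4) K) ^ jetColength p N s.F) =
          (X j : MvPolynomial (Fin 4) K) ^ jetColength p N s.F := by
        rw [map_pow]
        exact congrArg (· ^ jetColength p N s.F) (NarrowPullback.aeval_chart_X_self j b)
      rw [← himg]
      have hmem := Ideal.mem_map_of_mem
        (aeval (fun i => if i = j then (X j : MvPolynomial (Fin 4) K)
          else X j * (X i + C (b i)))).toRingHom (hx (M + 1))
      rw [Ideal.map_sup] at hmem
      refine (sup_le_sup (NarrowPullback.map_singLocusIdeal_le p s j b hbj hperm)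
        ((NarrowPullback.map_originIdeal_pow_le j b (M + 1)).trans ?_)) hmem
      rw [← Ideal.span_singleton_pow]
      exact Ideal.pow_right_mono (by
        rw [Ideal.span_le, Set.singleton_subset_iff]
        exact (NarrowApolarity.mem_originIdeal_iff _).mpr (constantCoeff_X K j)) _
  have hord' : ordZero (CentreBlowup.step p Finset.univ j b s).F = p :=
    NarrowTransversal.ordZero_step_eq p hord he hbj heq
  rcases NarrowTransversal.ebar_step_eq_zero_or_eq_one p hord he hbj heq with he0 | he1
  · -- `ē(s⁺) = 0`: `μ⁺(s⁺) ≤ 1`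
    have hbot : additiveSubspace (initialForm (CentreBlowup.step p Finset.univ j b s).F) = ⊥ :=
      Submodule.finrank_eq_zero.mp he0
    have h1 := jetColength_le_one_of_le_sup_sq
      (NarrowApolarity.originIdeal_le_sup_of_additiveSubspace_eq_bot hp2 hord' hbot) N'
    omega
  · -- `ē(s⁺) = 1`: the new ridge vector has `w'_j ≠ 0`; apolarity + span lemma
    obtain ⟨w', hw', hw'j⟩ := NarrowTransversal.exists_ridge_vector_step p hord he hbj heq he1
    have h1 := jetColength_le_of_X_pow_mem
      (NarrowApolarity.originIdeal_le_span_X_sup hp2 hord' he1 hw' hw'j) (hx' N')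
    omega

/-- (N1⁺), strict form: `μ⁺(s⁺) < μ⁺(s)` at every level `N'`. [OURS · (N1⁺)]
[cite: CossartJannsenSaito2020, Cor. 6.37 (qualitative prior art)] -/
theorem jetColength_step_lt (p : ℕ) [Fact p.Prime] [CharP K p] [DecidableEq K] {s : State K}
    (hord : ordZero s.F = p) (he : ebar s.F = 1) {N : ℕ} (hN : IsCert p N s.F) {j : Fin 4}
    {b : Fin 4 → K} (hbj : b j = 0) (heq : CentreBlowup.IsEquimultiplePoint p Finset.univ j b s)
    (N' : ℕ) :
    jetColength p N' (CentreBlowup.step p Finset.univ j b s).F < jetColength p N s.F :=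
  jetColength_step_succ_le p hord he hN hbj heq N'

/-- **Child isolation is automatic**: the successor of a certified narrow floor state at an
equimultiple point is again `J_p⁺`-isolated (its colengths are bounded by `μ⁺(s) − 1` at every
level, so some level is a certificate). [OURS · (N1⁺) corollary] [folklore] -/
theorem isIsolated_step_of_ebar_eq_one (p : ℕ) [Fact p.Prime] [CharP K p] [DecidableEq K]
    {s : State K} (hord : ordZero s.F = p) (he : ebar s.F = 1) {N : ℕ} (hN : IsCert p N s.F)
    {j : Fin 4} {b : Fin 4 → K} (hbj : b j = 0)
    (heq : CentreBlowup.IsEquimultiplePoint p Finset.univ j b s) :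
    IsIsolated p (CentreBlowup.step p Finset.univ j b s).F :=
  IsolationCert.isIsolated_of_finrank_lt
    (singLocusIdeal_le_originIdeal_of_ordZero_eq (NarrowTransversal.ordZero_step_eq p hord he hbj heq))
    (N := jetColength p N s.F) (jetColength_step_lt p hord he hN hbj heq _)

/-! ## 3. (N1) = idea-3's `RidgeBudget.NarrowDrop p p`, by name -/

/-- **(N1) `NarrowDrop p p` HOLDS for every prime `p`** (CARD I-3-7 / I-3-10 of the cell: along a
`Step0` edge from an isolated floor state with a one-dimensional ridge, the Hasse–Jacobian colength
`μ⁺`, read at any certificate levels, drops strictly).  The tree's typed census law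
(`PurelyInseparableDim4RidgeBudget`, p659279; census 0 exceptions / 18 035 narrow edges at `(3,3)`,
1 127 at `(5,5)`) is now a theorem; the hypotheses «`s'` isolated» and «certificate at `s'`» of the
typed statement are not used. [OURS · (N1) of CARD I-3-10 · counted 0 · AI kernel work]
[cite: CossartJannsenSaito2020, Cor. 6.37 (qualitative prior art)] -/
theorem narrowDrop (p : ℕ) [Fact p.Prime] : NarrowDrop p p := by
  intro K _ _ _ s s' N N' _ _ hstep hord he hN _
  obtain ⟨-, j, b, -, hbj, heq, -, rfl⟩ := hstep
  exact jetColength_step_lt p hord he hN hbj heq N'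

end RidgeBudget


end Summit.ResolutionOfSingularities.ResolutionOfSingularities.Theorems.PIDim4

end
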